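import Literature.Analysis.FluidPDE.LinearisedNSFourierPicard
import HarnessLib

/-!
# Picard iteration for the Fourier-transformed linearised Navier–Stokes equation: convergence, the limit

Analysis/FluidPDE proof file, fourth of the files `LinearisedNSFourier*` (objects in
`LinearisedNSFourierDefs`; the Duhamel map and its contraction estimate in
`LinearisedNSFourierPicard`). For data `(ν, T, U, a)` under `PicardHyp` the Picard iterates
`c₀ = 0`, `cₙ₊₁ = Φ(cₙ)` of the mild linearised equation converge on the whole interval
`[0, T]` (the vector twin of `ScalarFourierPicard`, § Iteration; Leray 1934, §19, for successive
approximations; Lemarié-Rieusset 2016, §8.5, for the weighted sup-norms):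

* `PicardHyp.iter_estimates`, `PicardHyp.iter_tendsto` — continuity of the iterates, geometric
  convergence with every polynomial decay uniformly in time;
* the limit `c = picardLim`: continuous in time (`continuous_picardLim`), every decay
  (`hasDecay_picardLim`), the mild equation `c = Φ(c)` (`picardLim_eq_picardMap`) and the datum
  `c(l, 0, k) = a(l, k)` (`picardLim_zero`);
* two structural properties read off the fixed-point equation: the limit is
  **Fourier-divergence free**, `∑ₗ kₗ c(l,t,k) = 0`, when the datum is
  (`sum_intCast_mul_picardLim`: the Duhamel integrand is a *projected* symbol,
  `sum_intCast_mul_linProjSym`), and its **zero mode vanishes**, `c(l,t,0) = 0`, when the datum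
  has vanishing zero mode and the drift is Fourier-divergence free (`picardLim_zero_freq`:
  `linProjSym_zero_freq`) — i.e. `div w = 0` and `∫ w = 0` propagate from the datum
  (Constantin–Foias 1988, Ch. 14: the linearised equation lives in `H`).

## References

* P. Constantin, C. Foias, *Navier–Stokes Equations*, Univ. Chicago Press 1988, Ch. 14, (14.3). [`ConstantinFoiasNSE1988`]
* P. G. Lemarié-Rieusset, *The Navier–Stokes problem in the 21st century*, CRC 2016, §8.5.
* J. Leray, Acta Math. 63 (1934), §19. [`Leray1934`]
-/

noncomputable section

open MeasureTheory Real Set Filter Topology UnitAddTorus intervalIntegral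

namespace Literature.Analysis.FluidPDE

namespace LinearisedNSFourier

open ScalarFourier
open CorrectorFourier (leraySym)
open FourierNS (HasDecay clamp)
open Literature.Analysis.FunctionSpaces.Torus (freqNormSq)

variable {d : Type*} [Fintype d] [DecidableEq d]
variable {ν T : ℝ} {U : d → ℝ → (d → ℤ) → ℂ} {a : d → (d → ℤ) → ℂ}

/-! ### The iteration: geometric convergence -/

section Iteration

omit [DecidableEq d] in
/-- **The iteration estimates.** With `λ` from `exists_contraction` and `D` an order-`K+1`
constant of the first iterate `c₁ = Φ(0)`, for every `n`: `cₙ` is continuous in time at each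
component and frequency, `‖cₙ₊₁(l,t) - cₙ(l,t)‖ ≤ D 2^{-n} e^{λ clamp t} (1+‖·‖)^{-(K+1)}` and
`‖cₙ(l,t)‖ ≤ 2D(1 - 2^{-n}) e^{λT} (1+‖·‖)^{-(K+1)}` (induction on `n`, as
`ScalarFourier.PicardHyp.iter_estimates`). [folklore] -/
theorem PicardHyp.iter_estimates [DecidableEq d] (h : PicardHyp ν T U a) {K : ℕ} (hK : latOrder d ≤ K)
    {lam : ℝ} (hlam : 1 ≤ lam)
    (hcontr : ∀ (c₁ c₂ : d → ℝ → (d → ℤ) → ℂ) (X₁ X₂ D : ℝ),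
      (∀ l m, Continuous fun t => c₁ l t m) → (∀ l m, Continuous fun t => c₂ l t m) →
      (∀ l t, HasDecay (latOrder d + 1) X₁ (c₁ l t)) → (∀ l t, HasDecay (latOrder d + 1) X₂ (c₂ l t)) →
      0 ≤ D →
      (∀ l t, HasDecay (K + 1) (D * Real.exp (lam * clamp T t)) (fun m => c₁ l t m - c₂ l t m)) →
      ∀ l t, HasDecay (K + 1) (1 / 2 * D * Real.exp (lam * clamp T t))
        (fun k => picardMap ν T U a c₁ l t k - picardMap ν T U a c₂ l t k))
    {D : ℝ} (hD : 0 ≤ D) (hbase : ∀ l t, HasDecay (K + 1) D (picardMap ν T U a (fun _ _ _ => 0) l t))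
    (n : ℕ) :
    (∀ l m, Continuous fun t => picardIter ν T U a n l t m) ∧
    (∀ l t, HasDecay (K + 1) (D * (1 / 2) ^ n * Real.exp (lam * clamp T t))
      (fun m => picardIter ν T U a (n + 1) l t m - picardIter ν T U a n l t m)) ∧
    (∀ l t, HasDecay (K + 1) (2 * D * (1 - (1 / 2) ^ n) * Real.exp (lam * T))
      (picardIter ν T U a n l t)) := by
  have hlam0 : 0 ≤ lam := by linarith
  have hK1 : latOrder d + 1 ≤ K + 1 := by omega
  induction n with
  | zero =>
    refine ⟨fun l m => ?_, fun l t => ?_, fun l t => ?_⟩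
    · simpa using continuous_const
    · intro m
      have h1 := hbase l t m
      simp only [picardIter_succ, picardIter_zero, sub_zero, pow_zero, mul_one]
      exact h1.trans (mul_le_mul_of_nonneg_right
        (le_mul_of_one_le_right hD (one_le_exp_clamp hlam0 t)) (by positivity))
    · intro m
      simp
  | succ n ih =>
    obtain ⟨hcont, hdiff, hbound⟩ := ih
    -- (iii) at `n + 1`
    have hbound' : ∀ l t, HasDecay (K + 1) (2 * D * (1 - (1 / 2) ^ (n + 1)) * Real.exp (lam * T))
        (picardIter ν T U a (n + 1) l t) := by
      intro l t m
      have h1 := hbound l t m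
      have h2 := hdiff l t m
      have hexp := exp_clamp_le (T := T) hlam0 h.hT.le t
      calc ‖picardIter ν T U a (n + 1) l t m‖ ≤ ‖picardIter ν T U a n l t m‖ +
            ‖picardIter ν T U a (n + 1) l t m - picardIter ν T U a n l t m‖ := norm_le_insert' _ _
        _ ≤ 2 * D * (1 - (1 / 2) ^ n) * Real.exp (lam * T) * ((1 + ‖m‖) ^ (K + 1))⁻¹ +
            D * (1 / 2) ^ n * Real.exp (lam * clamp T t) * ((1 + ‖m‖) ^ (K + 1))⁻¹ :=
          add_le_add h1 h2
        _ ≤ 2 * D * (1 - (1 / 2) ^ n) * Real.exp (lam * T) * ((1 + ‖m‖) ^ (K + 1))⁻¹ +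
            D * (1 / 2) ^ n * Real.exp (lam * T) * ((1 + ‖m‖) ^ (K + 1))⁻¹ := by gcongr
        _ = 2 * D * (1 - (1 / 2) ^ (n + 1)) * Real.exp (lam * T) * ((1 + ‖m‖) ^ (K + 1))⁻¹ := by
          ring
    -- (i) at `n + 1`
    have hcont' : ∀ l m, Continuous fun t => picardIter ν T U a (n + 1) l t m := fun l m => by
      simp only [picardIter_succ]
      exact h.continuous_picardMap hcont (fun l t => (hbound l t).of_le hK1) l m
    -- (ii) at `n + 1`
    refine ⟨hcont', fun l t => ?_, hbound'⟩
    have key := hcontr (picardIter ν T U a (n + 1)) (picardIter ν T U a n) _ _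
      (D * (1 / 2) ^ n) hcont' hcont (fun l t => (hbound' l t).of_le hK1)
      (fun l t => (hbound l t).of_le hK1) (by positivity) hdiff l t
    simp only [picardIter_succ] at key ⊢
    convert key using 2
    ring

/-- **Convergence of the Picard iteration with all estimates.** For every order `K ≥ 2#d`
there are `R ≥ 0` and the weight `λ ≥ 1` of `exists_contraction` such that all iterates are
continuous in time, `‖cₙ(l,t)‖ ≤ R (1+‖·‖)^{-(K+1)}`, and `cₙ → c = picardLim` with
`‖cₙ(l,t) - c(l,t)‖ ≤ R 2^{-n} (1+‖·‖)^{-(K+1)}` uniformly in `t` (geometric series; Mathlib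
`cauchySeq_of_le_geometric`, `dist_le_of_le_geometric_of_tendsto`). [folklore] -/
theorem PicardHyp.iter_tendsto (h : PicardHyp ν T U a) {K : ℕ} (hK : latOrder d ≤ K) :
    ∃ R lam : ℝ, 0 ≤ R ∧ 1 ≤ lam ∧
      (∀ (c₁ c₂ : d → ℝ → (d → ℤ) → ℂ) (X₁ X₂ D : ℝ),
        (∀ l m, Continuous fun t => c₁ l t m) → (∀ l m, Continuous fun t => c₂ l t m) →
        (∀ l t, HasDecay (latOrder d + 1) X₁ (c₁ l t)) → (∀ l t, HasDecay (latOrder d + 1) X₂ (c₂ l t)) →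
        0 ≤ D →
        (∀ l t, HasDecay (K + 1) (D * Real.exp (lam * clamp T t)) (fun m => c₁ l t m - c₂ l t m)) →
        ∀ l t, HasDecay (K + 1) (1 / 2 * D * Real.exp (lam * clamp T t))
          (fun k => picardMap ν T U a c₁ l t k - picardMap ν T U a c₂ l t k)) ∧
      (∀ n l m, Continuous fun t => picardIter ν T U a n l t m) ∧
      (∀ n l t, HasDecay (K + 1) R (picardIter ν T U a n l t)) ∧
      (∀ l t m, Tendsto (fun n => picardIter ν T U a n l t m) atTop (𝓝 (picardLim ν T U a l t m))) ∧
      (∀ n l t, HasDecay (K + 1) (R * (1 / 2) ^ n)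
        (fun m => picardIter ν T U a n l t m - picardLim ν T U a l t m)) := by
  obtain ⟨lam, hlam, hcontr⟩ := h.exists_contraction hK
  obtain ⟨D, hD, ha⟩ := h.decayA_nonneg (K + 1)
  have hbase : ∀ l t, HasDecay (K + 1) D (picardMap ν T U a (fun _ _ _ => 0) l t) :=
    h.hasDecay_picardMap_zero ha
  have hest := h.iter_estimates hK hlam hcontr hD hbase
  have hlam0 : 0 ≤ lam := by linarith
  set R := 2 * D * Real.exp (lam * T) with hR
  have hR0 : 0 ≤ R := by positivity
  -- the geometric bound on consecutive differences, uniformly in `t`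
  have hstep : ∀ l t m n, dist (picardIter ν T U a n l t m) (picardIter ν T U a (n + 1) l t m) ≤
      D * Real.exp (lam * T) * ((1 + ‖m‖) ^ (K + 1))⁻¹ * (1 / 2) ^ n := by
    intro l t m n
    rw [dist_eq_norm, norm_sub_rev]
    have h1 := (hest n).2.1 l t m
    have hexp := exp_clamp_le (T := T) hlam0 h.hT.le t
    calc _ ≤ D * (1 / 2) ^ n * Real.exp (lam * clamp T t) * ((1 + ‖m‖) ^ (K + 1))⁻¹ := h1
      _ ≤ D * (1 / 2) ^ n * Real.exp (lam * T) * ((1 + ‖m‖) ^ (K + 1))⁻¹ := by gcongr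
      _ = _ := by ring
  have hcauchy : ∀ l t m, CauchySeq fun n => picardIter ν T U a n l t m := fun l t m =>
    cauchySeq_of_le_geometric (1 / 2) _ (by norm_num) (hstep l t m)
  have htend : ∀ l t m, Tendsto (fun n => picardIter ν T U a n l t m) atTop
      (𝓝 (picardLim ν T U a l t m)) := fun l t m => (hcauchy l t m).tendsto_limUnder
  have herr : ∀ n l t m, ‖picardIter ν T U a n l t m - picardLim ν T U a l t m‖ ≤
      R * (1 / 2) ^ n * ((1 + ‖m‖) ^ (K + 1))⁻¹ := by
    intro n l t m
    have h1 := dist_le_of_le_geometric_of_tendsto (1 / 2) _ (by norm_num) (hstep l t m) (htend l t m) n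
    rw [dist_eq_norm] at h1
    refine h1.trans_eq ?_
    simp only [hR]
    ring
  refine ⟨R, lam, hR0, hlam, hcontr, fun n => (hest n).1, fun n l t m => ?_, htend,
    fun n l t m => herr n l t m⟩
  have h1 := (hest n).2.2 l t m
  refine h1.trans (mul_le_mul_of_nonneg_right ?_ (by positivity))
  simp only [hR]
  have : (0:ℝ) ≤ (1 / 2) ^ n := by positivity
  nlinarith [Real.exp_pos (lam * T)]

/-- The Picard limit is continuous in time at each component and frequency (uniform limit of
continuous functions, Mathlib `TendstoUniformly.continuous`). [folklore] -/
theorem PicardHyp.continuous_picardLim (h : PicardHyp ν T U a) (l : d) (m : d → ℤ) :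
    Continuous fun t => picardLim ν T U a l t m := by
  obtain ⟨R, lam, hR0, -, -, hcont, -, -, herr⟩ := h.iter_tendsto le_rfl
  have hunif : TendstoUniformly (fun n t => picardIter ν T U a n l t m)
      (fun t => picardLim ν T U a l t m) atTop := by
    refine Metric.tendstoUniformly_iff.2 fun ε hε => ?_
    have hgeo : Tendsto (fun n : ℕ => R * (1 / 2 : ℝ) ^ n) atTop (𝓝 0) := by
      have := tendsto_pow_atTop_nhds_zero_of_lt_one (r := (1 / 2 : ℝ)) (by norm_num) (by norm_num)
      simpa using this.const_mul R
    filter_upwards [(tendsto_order.1 hgeo).2 ε hε] with n hn t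
    rw [dist_comm, dist_eq_norm]
    have h1 := herr n l t m
    have hw : ((1 + ‖m‖) ^ (latOrder d + 1))⁻¹ ≤ 1 := FourierNS.inv_one_add_norm_pow_le_one m _
    calc _ ≤ R * (1 / 2) ^ n * ((1 + ‖m‖) ^ (latOrder d + 1))⁻¹ := h1
      _ ≤ R * (1 / 2) ^ n * 1 := by gcongr
      _ < ε := by rw [mul_one]; exact hn
  exact hunif.continuous (Frequently.of_forall fun n => hcont n l m)

/-- **Every polynomial decay of the Picard limit**, uniformly in time and component. [folklore] -/
theorem PicardHyp.hasDecay_picardLim (h : PicardHyp ν T U a) (K : ℕ) :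
    ∃ C : ℝ, 0 ≤ C ∧ ∀ l t, HasDecay K C (picardLim ν T U a l t) := by
  obtain ⟨R, lam, hR0, -, -, -, -, -, herr⟩ := h.iter_tendsto (le_max_left (latOrder d) K)
  refine ⟨R, hR0, fun l t m => ?_⟩
  have h1 := herr 0 l t m
  simp only [picardIter_zero, zero_sub, norm_neg, pow_zero, mul_one] at h1
  exact h1.trans (mul_le_mul_of_nonneg_left
    (FourierNS.inv_one_add_norm_pow_anti m (by omega)) hR0)

/-- **The Picard limit is a fixed point of the Duhamel map**: `c = Φ(c)`, i.e. the mild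
equation `c(l,t,k) = e^{-νₖτ} a(l,k) - ∫₀^τ e^{-νₖ(τ-s)} (P linSym)(U(s), c(s))(l,k) ds`,
`τ = clamp T t`. [folklore] -/
theorem PicardHyp.picardLim_eq_picardMap (h : PicardHyp ν T U a) (l : d) (t : ℝ) (k : d → ℤ) :
    picardLim ν T U a l t k = picardMap ν T U a (picardLim ν T U a) l t k := by
  obtain ⟨R, lam, hR0, hlam, hcontr, hcont, hdec, -, herr⟩ := h.iter_tendsto le_rfl
  have hlam0 : 0 ≤ lam := by linarith
  set c := picardLim ν T U a with hc
  have hcc : ∀ l m, Continuous fun t => c l t m := h.continuous_picardLim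
  have hcd : ∀ l t, HasDecay (latOrder d + 1) R (c l t) := fun l t m => by
    have h1 := herr 0 l t m
    simpa [picardIter_zero] using h1
  -- `‖Φc - c‖ ≤ ½ R 2^{-n} e^{λ clamp t} w + R 2^{-(n+1)} w` for every `n`
  have hbound : ∀ n : ℕ, ‖picardMap ν T U a c l t k - c l t k‖ ≤
      (1 / 2 * (R * (1 / 2) ^ n) * Real.exp (lam * clamp T t) + R * (1 / 2) ^ (n + 1)) *
        ((1 + ‖k‖) ^ (latOrder d + 1))⁻¹ := by
    intro n
    have hdiff : ∀ l t, HasDecay (latOrder d + 1) (R * (1 / 2) ^ n * Real.exp (lam * clamp T t))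
        (fun m => c l t m - picardIter ν T U a n l t m) := by
      intro l t m
      have h1 := herr n l t m
      rw [norm_sub_rev] at h1
      exact h1.trans (mul_le_mul_of_nonneg_right
        (le_mul_of_one_le_right (by positivity) (one_le_exp_clamp hlam0 t)) (by positivity))
    have key := hcontr c (picardIter ν T U a n) R R (R * (1 / 2) ^ n) hcc (hcont n) hcd
      (fun l t => hdec n l t) (by positivity) hdiff l t k
    rw [← picardIter_succ] at key
    have h2 := herr (n + 1) l t k
    calc ‖picardMap ν T U a c l t k - c l t k‖
        ≤ ‖picardMap ν T U a c l t k - picardIter ν T U a (n + 1) l t k‖ +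
          ‖picardIter ν T U a (n + 1) l t k - c l t k‖ := norm_sub_le_norm_sub_add_norm_sub _ _ _
      _ ≤ _ := add_le_add key h2
      _ = _ := by ring
  have hlim : Tendsto (fun n : ℕ => (1 / 2 * (R * (1 / 2) ^ n) * Real.exp (lam * clamp T t) +
      R * (1 / 2) ^ (n + 1)) * ((1 + ‖k‖) ^ (latOrder d + 1))⁻¹) atTop (𝓝 0) := by
    have hg := tendsto_pow_atTop_nhds_zero_of_lt_one (r := (1 / 2 : ℝ)) (by norm_num) (by norm_num)
    have h1 : Tendsto (fun n : ℕ => (1 / 2 * (R * (1 / 2 : ℝ) ^ n) * Real.exp (lam * clamp T t) +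
        R * (1 / 2) ^ (n + 1))) atTop (𝓝 0) := by
      have e1 := (hg.const_mul R).const_mul (1 / 2 : ℝ)
      have e2 := e1.mul_const (Real.exp (lam * clamp T t))
      have e3 := (hg.comp (tendsto_add_atTop_nat 1)).const_mul R
      simp only [mul_zero, zero_mul] at e2 e3
      have := e2.add e3
      simp only [add_zero] at this
      refine this.congr fun n => ?_
      simp only [Function.comp_apply]
    simpa using h1.mul_const (((1 + ‖k‖) ^ (latOrder d + 1))⁻¹)
  have h0 : ‖picardMap ν T U a c l t k - c l t k‖ ≤ 0 :=
    ge_of_tendsto' hlim fun n => hbound n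
  have := norm_le_zero_iff.1 h0
  rw [sub_eq_zero] at this
  exact this.symm

/-- The Duhamel map at time `0` returns the datum: `Φ(c)(l, 0, k) = a(l, k)`. [folklore] -/
theorem picardMap_zero_time (hT : 0 ≤ T) (c : d → ℝ → (d → ℤ) → ℂ) (l : d) (k : d → ℤ) :
    picardMap ν T U a c l 0 k = a l k := by
  simp [picardMap, FourierNS.clamp_zero hT]

/-- **The Picard limit attains the datum**: `c(l, 0, k) = a(l, k)`. [folklore] -/
theorem PicardHyp.picardLim_zero (h : PicardHyp ν T U a) (l : d) (k : d → ℤ) :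
    picardLim ν T U a l 0 k = a l k := by
  rw [h.picardLim_eq_picardMap l 0 k, picardMap_zero_time h.hT.le]

end Iteration

/-! ### Divergence freedom and the zero mode, from the fixed-point equation -/

section Structure

/-- **The Duhamel map produces Fourier-divergence-free fields from a Fourier-divergence-free
datum**: `∑ₗ kₗ Φ(c)(l, t, k) = 0` for every `c` continuous in time with uniform decay of order
`2#d + 1`, if `∑ₗ kₗ a(l, k) = 0` (the integrand is the projected symbol,
`sum_intCast_mul_linProjSym`; adapted from `CorrectorFourier.DataHyp.sum_intCast_mul_picardMap`). [folklore] -/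
theorem PicardHyp.sum_intCast_mul_picardMap (h : PicardHyp ν T U a)
    (hadiv : ∀ k, ∑ l, (k l : ℂ) * a l k = 0) {c : d → ℝ → (d → ℤ) → ℂ} {X : ℝ}
    (hcc : ∀ l m, Continuous fun t => c l t m) (hc : ∀ l t, HasDecay (latOrder d + 1) X (c l t))
    (t : ℝ) (k : d → ℤ) : ∑ l, (k l : ℂ) * picardMap ν T U a c l t k = 0 := by
  set τ := clamp T t with hτdef
  have hi : ∀ l, IntervalIntegrable (fun s => (heatFactor ν k (τ - s) : ℂ) *
      linProjSym (fun j => U j s) (fun j => c j s) l k) volume 0 τ := fun l =>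
    (h.continuous_integrand hcc hc l k τ).intervalIntegrable _ _
  have hdat : ∑ l, (k l : ℂ) * ((heatFactor ν k τ : ℂ) * a l k) = 0 := by
    calc ∑ l, (k l : ℂ) * ((heatFactor ν k τ : ℂ) * a l k)
        = (heatFactor ν k τ : ℂ) * ∑ l, (k l : ℂ) * a l k := by
          rw [Finset.mul_sum]
          refine Finset.sum_congr rfl fun l _ => ?_
          ring
      _ = 0 := by rw [hadiv k, mul_zero]
  simp only [picardMap, ← hτdef, mul_sub, Finset.sum_sub_distrib, hdat, zero_sub, neg_eq_zero]
  simp_rw [← intervalIntegral.integral_const_mul]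
  rw [← intervalIntegral.integral_finsetSum fun l _ => (hi l).const_mul _]
  have hzero : ∀ s, ∑ l, (k l : ℂ) * ((heatFactor ν k (τ - s) : ℂ) *
      linProjSym (fun j => U j s) (fun j => c j s) l k) = 0 := by
    intro s
    have h0 := sum_intCast_mul_linProjSym (fun j => U j s) (fun j => c j s) k
    calc ∑ l, (k l : ℂ) * ((heatFactor ν k (τ - s) : ℂ) *
          linProjSym (fun j => U j s) (fun j => c j s) l k)
        = (heatFactor ν k (τ - s) : ℂ) *
            ∑ l, (k l : ℂ) * linProjSym (fun j => U j s) (fun j => c j s) l k := by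
          rw [Finset.mul_sum]
          refine Finset.sum_congr rfl fun l _ => ?_
          ring
      _ = 0 := by rw [h0, mul_zero]
  have hfun : (fun s => ∑ l, (k l : ℂ) * ((heatFactor ν k (τ - s) : ℂ) *
      linProjSym (fun j => U j s) (fun j => c j s) l k)) = fun _ => 0 := funext hzero
  rw [hfun, intervalIntegral.integral_zero]

/-- **The Picard limit is Fourier-divergence free** when the datum is:
`∑ₗ kₗ c(l, t, k) = 0` (`div w(t) = 0` propagates from `div w₀ = 0`; read off `c = Φ(c)`). [folklore] -/
theorem PicardHyp.sum_intCast_mul_picardLim (h : PicardHyp ν T U a)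
    (hadiv : ∀ k, ∑ l, (k l : ℂ) * a l k = 0) (t : ℝ) (k : d → ℤ) :
    ∑ l, (k l : ℂ) * picardLim ν T U a l t k = 0 := by
  obtain ⟨R, -, hR⟩ := h.hasDecay_picardLim (latOrder d + 1)
  have hcc : ∀ l m, Continuous fun t => picardLim ν T U a l t m := h.continuous_picardLim
  have hfix : ∀ l, picardLim ν T U a l t k = picardMap ν T U a (picardLim ν T U a) l t k := fun l =>
    h.picardLim_eq_picardMap l t k
  simp_rw [hfix]
  exact h.sum_intCast_mul_picardMap hadiv hcc hR t k

/-- **The Picard limit has vanishing zero mode** (zero spatial mean of the synthesized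
velocity, propagated from the datum): if `a(l, 0) = 0`, the drift coefficients are
Fourier-divergence free (`∑ⱼ mⱼ Uⱼ(t, m) = 0`, from `div u = 0`) and the datum is, then
`c(l, t, 0) = 0` — at the zero frequency the heat factor multiplies `a(l,0) = 0` and the
projected symbol vanishes (`linProjSym_zero_freq`, using the divergence freedom of `c` itself,
`sum_intCast_mul_picardLim`). [folklore] -/
theorem PicardHyp.picardLim_zero_freq (h : PicardHyp ν T U a) (ha0 : ∀ l, a l 0 = 0)
    (hadiv : ∀ k, ∑ l, (k l : ℂ) * a l k = 0) (hUdiv : ∀ t m, ∑ j, (m j : ℂ) * U j t m = 0)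
    (l : d) (t : ℝ) : picardLim ν T U a l t 0 = 0 := by
  obtain ⟨R, -, hR⟩ := h.hasDecay_picardLim (latOrder d + 1)
  obtain ⟨A, hA⟩ := h.decayU (latOrder d + 1)
  have hcdiv : ∀ s m, ∑ j, (m j : ℂ) * picardLim ν T U a j s m = 0 := h.sum_intCast_mul_picardLim hadiv
  rw [h.picardLim_eq_picardMap l t 0, picardMap]
  have hzero : ∀ s, linProjSym (fun j => U j s) (fun j => picardLim ν T U a j s) l 0 = 0 := fun s =>
    linProjSym_zero_freq (fun j => hA j s) (fun j => hR j s) (hUdiv s) (hcdiv s) l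
  simp_rw [hzero, mul_zero, intervalIntegral.integral_zero, sub_zero, ha0 l, mul_zero]

end Structure

end LinearisedNSFourier

end Literature.Analysis.FluidPDE

end
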